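import Literature.MathematicalPhysics.QuantumFieldTheory.Balaban1983to89.B9Eq326OperatorTower

/-!
# `Balaban1983to89.B9Eq315QTowerFlat` — T. Bałaban, *Propagators for lattice gauge theories in a background field*, Commun. Math. Phys. **99**
# (1985) 389–434 [Balaban1985BackgroundPropagators] (3.15) p. 393 AT THE FLAT BACKGROUND `U ≡ 1`: the tower of averaged backgrounds is flat,
# the composite averaging `Q_k(1)` reproduces constants (the `(L^k)⁻¹` normalisation pinned end to end), and `Q_k(1)` is onto with NO
# displayed datum

statement-level skeleton of published theorems with citation tags; proofs where landed; nothing here is a claim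
about the Yang–Mills mass gap

CITATION HEADER (lean-in-tree rule).  Audit cell `pub-balaban`, sub-cell `t4`, row NE9; filed by the NE9 crux-team leaf seat
`b2b-balaban-t4-ne9-formalise-leaf-02` (gen 50) ON THE ROW OWNER's WORD (`b2b-balaban-t4-ne9-p1` gen 78, journal l.35687: «your (R9)–(R15)
flat-tower items … leaf-02 may file them as ONE proof-lane sequel `B9Eq315QTowerFlat.lean`»); the items are the reader lemmas of this seat's
cross-reads C-ne9leaf02g49-5 ∕ -6 of `B9Eq315QTower` (p301135) and `B9Eq326OperatorTower` (p301454), re-homed verbatim up to names.  Sources READ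
by this seat in the held texts: [Balaban1985BackgroundPropagators] p. 393 (`paper:balaban1985-cmp99-background-propagators`, journal page = PDF page
+ 388) and T. Bałaban, *Averaging operations for lattice gauge theories*, Commun. Math. Phys. **98** (1985) 17–51 [Balaban1985Averaging] pp. 23–24,
36–37 (`paper:balaban1985-cmp98-averaging`, journal page = PDF page + 16).

THE PRINT.  [Balaban1985BackgroundPropagators] (3.15) p. 393: *«Q_j(U) = Q(Ū^{j−1})…Q(Ū)Q(U), (3.15) where Q(V) is given by the explicit formula
(124) in [5].»*  [Balaban1985Averaging] (42)–(43) pp. 23–24 (the one-step average `Ū` and the `k`-th order average `Ū^k`), (124) p. 36 (the linear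
form `Q(V₀)A`, main term `Σ_{x∈B(c₋)} L^{−d+1} R(…)·(…)`: *«The first term on the right-hand side above is the main term in this linear form, and it
resembles the definition of the averaging operation Q in [2]. The remaining terms are small because the functions g(−z), g⁻¹(z), e^{iz} are equal
to 1 for z = 0»*), (127) p. 37 (the composites `Q_j(U₀)`).  At `V₀ = 1` every rotation `R` in (124) is the identity and the remaining terms vanish,
so `Q(1)` is the plain block-and-segment average; this file records that consequence for the cell's typed objects.

WHAT IS PROVED (sorry-free; proof lane — no `def`, no `Prop` placeholder, no inequality of the paper).
* §1 **`UlevOf_one`**: the level backgrounds of the flat background are flat, `UlevOf L m k 1 n = 1` (`B7Eq92Concrete.avgIter_one` = (43) at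
  `U = 1`, read on the tower tori); hence the per-level data DISPLAYED by `B9Eq315QTower.Qtower`∕`QkOfU` and by `B9Eq326OperatorTower.QkW` are
  INHABITED at `U = 1`: `perCfg_UlevOf_one_mem_U1` (unit-boundedness) and `norm_Wcx_UlevOf_one_sub_one_le` (block-loop regularity, any `α_n ≥ 0`).
* §2 **`QtorusLin_one_const`**: the one-step factor at the flat background reproduces constants on every torus of the tower, `Q(1)(const a) =
  const a` (`B7Prop3GeneralLinear.linQcov_one_left` → `B7Prop3Flat.linQ` → `L^d·L` equal summands against the `L^{−d}`, `L⁻¹` normalisations);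
  `QtorusLin_const_of_eq_one` transports it along any proof `V = 1` (the displayed data ride along by `subst`).
* §3 **`Qtower_one_const`** ∕ **`QkOfU_one_const`**: `Q_k(1)(const a) = const a` — `k` one-step factors, each an exact average; and, through
  `B9Eq315QTower.QkOfU_apply_eq_linCovIter`, **`linCovIter_one_const`**: the un-normalised composite (127) at the flat background scales constants by
  EXACTLY `L^k` — the `(L^k)⁻¹` of the identification is what makes `Q_k` an average.
* §4 **`QkOfU_one_surjective`** ∕ **`QkW_one_surjective`**: `Q_k(1)` (on bond functions, and on the weighted `L²` spaces of `B9Eq326OperatorTower`)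
  is ONTO with no displayed datum but `1 ≤ L` — the flat tower with `α_n := 0` inhabits every hypothesis of `QkOfU_surjective` ∕ `QkW_surjective`.
WHY (cell context).  Non-vacuity ∕ normalisation witnesses for the NE9 letter chain's tower files: the displayed per-level background data of
(D) `B9Eq315QTower` and (E) `B9Eq326OperatorTower` ([Balaban1985Averaging] Prop. 2 (52)–(54) p. 26 at a general background — NOT proved in the
tree) are jointly satisfiable, and the tree's normalisation conventions (READING C-adv4-22: one-step factor `L⁻¹`, composite `(L^k)⁻¹`) are the
ones under which `Q_k` fixes constants.  Nothing here is used to discharge those data at a non-flat background.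
HONEST SCOPE.  Elementary specialisation at `U ≡ 1` of landed definitions; no estimate of the paper; NOT summit progress (cell pub-balaban: NE9
NOT PRINTED ∕ NOT PROVED; spine PROVED 0∕9).  NEW file; nothing modified.  Net new unproved facts: 0.
-/

noncomputable section

open scoped BigOperators

namespace Literature.MathematicalPhysics.QuantumFieldTheory.Balaban1983to89.B9Eq315QTowerFlat

open B4Sect5Torus (TSite)
open B9SectCLatticeCarrier (Bond)
open B7Prop1Explicit (U1 Wcx boxVec asum_seg_natCast)
open B7Eq92Concrete (avgIter_one)
open B7Prop3Flat (linQ)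
open B7Prop3GeneralLinear (linQcov_one_left)
open B7Prop4GeneralLevels (linCovIter)
open B9Eq319QprimeTorus (fineP)
open B9Eq315QTorus (perCfg cornerSite QtorusLin QtorusLin_apply)
open B9Eq315QTorusOnto (liftSite)
open B9Eq315QTower (towerP UlevOf Qtower QkOfU QkOfU_surjective QkOfU_apply_eq_linCovIter)
open B9Eq326OperatorTower (QkW QkW_surjective)

variable {d : ℕ} {𝔸 : Type*} [NormedRing 𝔸] [NormedAlgebra ℂ 𝔸] [CompleteSpace 𝔸] [NormOneClass 𝔸]
variable (L : ℕ) [NeZero L] (m : Fin d → ℕ) [∀ i, NeZero (m i)] (hL : 1 ≤ L) (k : ℕ)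

/-! ## §1 The flat tower: `Ū^j(1) = 1` read on the level tori, and the displayed per-level data at `U = 1` -/

omit [NormOneClass 𝔸] in
/-- **The level backgrounds of the flat background are flat**: `UlevOf L m k 1 n = 1` — print's `Ū^{k−1−n}` of the configuration `1` is `1`
((43) iterated from `1̄ = 1`, `B7Eq92Concrete.avgIter_one`). [cite: Balaban1985Averaging, (42)–(43) pp.23–24; Balaban1985BackgroundPropagators, (3.15) p.393] -/
theorem UlevOf_one (n : ℕ) : UlevOf L m k (fun _ : Bond d (towerP L m k) => (1 : 𝔸ˣ)) n = fun _ => 1 := by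
  funext b
  rw [UlevOf, show perCfg (towerP L m k) (fun _ : Bond d (towerP L m k) => (1 : 𝔸ˣ)) = 1 from rfl, avgIter_one]
  rfl

/-- The tower's displayed unit-boundedness datum `hU1` HOLDS at the flat background (every level background is `1 ∈ U1`).
[cite: Balaban1985Averaging, (43) p.24, Prop. 2 (52) p.26] -/
theorem perCfg_UlevOf_one_mem_U1 : ∀ (n : ℕ) (x : B7Prop1Explicit.Site d) (κ : Fin d),
    perCfg (towerP L m (n + 1)) (UlevOf L m k (fun _ : Bond d (towerP L m k) => (1 : 𝔸ˣ)) n) x κ ∈ U1 𝔸 := by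
  intro n x κ; rw [UlevOf_one]; exact Subgroup.one_mem _

omit [NormOneClass 𝔸] in
/-- The tower's displayed block-loop regularity datum `hreg` HOLDS at the flat background for ANY nonnegative profile `α`: every block
loop of `1` is `1` (`B8Ineq130.Wcx_one`). [cite: Balaban1985Averaging, (43) p.24, Prop. 2 (53)–(54) p.26] -/
theorem norm_Wcx_UlevOf_one_sub_one_le (α : ℕ → ℝ) (hα0 : ∀ n, 0 ≤ α n) :
    ∀ (n : ℕ) (y : TSite d (towerP L m n)) (κ : Fin d) (r : Fin d → Fin L),
      ‖((Wcx L (perCfg (towerP L m (n + 1)) (UlevOf L m k (fun _ : Bond d (towerP L m k) => (1 : 𝔸ˣ)) n)) (cornerSite L y) κ (boxVec L r) :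
          𝔸ˣ) : 𝔸) - 1‖ ≤ α n := by
  intro n y κ r
  rw [UlevOf_one, show perCfg (towerP L m (n + 1)) (fun _ : Bond d (towerP L m (n + 1)) => (1 : 𝔸ˣ)) = 1 from rfl, B8Ineq130.Wcx_one,
    Units.val_one, sub_self, norm_zero]
  exact hα0 n

/-! ## §2 One step: `Q(1)` reproduces constants on every torus -/

include hL in
omit [NeZero L] [∀ i, NeZero (m i)] in
/-- **The one-step factor at the flat background reproduces `κ`-constants**: `Q(1)(const a) = const a` on the torus `T_{L·P} → T_P` — at
`V₀ = 1` the linear form (124) is its main term, the plain average over the `L^d` block sites and the `L` segment bonds, against the tree's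
`L^{−d}`∕`L⁻¹` normalisations. [cite: Balaban1985Averaging, (124) p.36; Balaban1985BackgroundPropagators, (3.15) p.393] -/
theorem QtorusLin_one_const (P : Fin d → ℕ) [∀ i, NeZero (P i)] [∀ i, NeZero (fineP L P i)] {α : ℝ} (hα1 : α ≤ 1 / 64)
    (hU1 : ∀ (x : B7Prop1Explicit.Site d) (κ : Fin d), perCfg (fineP L P) (fun _ : Bond d (fineP L P) => (1 : 𝔸ˣ)) x κ ∈ U1 𝔸)
    (hreg : ∀ (y : TSite d P) (κ : Fin d) (r : Fin d → Fin L),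
      ‖((Wcx L (perCfg (fineP L P) (fun _ : Bond d (fineP L P) => (1 : 𝔸ˣ))) (cornerSite L y) κ (boxVec L r) : 𝔸ˣ) : 𝔸) - 1‖ ≤ α)
    (a : 𝔸) (c : Bond d P) :
    QtorusLin L P hL (fun _ => 1) hα1 hU1 hreg (fun _ => a) c = a := by
  have hL0 : L ≠ 0 := by omega
  have hLr : (L : ℝ) ≠ 0 := by exact_mod_cast hL0
  have hLc : (L : ℂ) ≠ 0 := by exact_mod_cast hL0
  rw [QtorusLin_apply, show perCfg (fineP L P) (fun _ : Bond d (fineP L P) => (1 : 𝔸ˣ)) = 1 from rfl,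
    show perCfg (fineP L P) (fun _ : Bond d (fineP L P) => a) = fun _ _ => a from rfl,
    linQcov_one_left L hL _ (norm_nonneg a) (fun _ _ => le_rfl)]
  simp only [linQ, asum_seg_natCast, Finset.sum_const, Finset.card_range, Finset.card_univ, Fintype.card_pi, Finset.prod_const,
    Fintype.card_fin]
  rw [← Nat.cast_smul_eq_nsmul ℝ (L ^ d), smul_smul, Nat.cast_pow, mul_inv_cancel₀ (pow_ne_zero _ hLr), one_smul,
    ← Nat.cast_smul_eq_nsmul ℂ L, smul_smul, inv_mul_cancel₀ hLc, one_smul]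

include hL in
omit [NeZero L] [∀ i, NeZero (m i)] in
/-- The same for any background PROVABLY equal to the flat one (the displayed data are transported along the equation).
[cite: Balaban1985Averaging, (124) p.36; Balaban1985BackgroundPropagators, (3.15) p.393] -/
theorem QtorusLin_const_of_eq_one (P : Fin d → ℕ) [∀ i, NeZero (P i)] [∀ i, NeZero (fineP L P i)] {V : Bond d (fineP L P) → 𝔸ˣ}
    (hV : V = fun _ => 1) {α : ℝ} (hα1 : α ≤ 1 / 64) (hU1 : ∀ (x : B7Prop1Explicit.Site d) (κ : Fin d), perCfg (fineP L P) V x κ ∈ U1 𝔸)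
    (hreg : ∀ (y : TSite d P) (κ : Fin d) (r : Fin d → Fin L),
      ‖((Wcx L (perCfg (fineP L P) V) (cornerSite L y) κ (boxVec L r) : 𝔸ˣ) : 𝔸) - 1‖ ≤ α)
    (a : 𝔸) (c : Bond d P) :
    QtorusLin L P hL V hα1 hU1 hreg (fun _ => a) c = a := by
  subst hV; exact QtorusLin_one_const L hL P hα1 hU1 hreg a c

/-! ## §3 The tower: `Q_k(1)` reproduces constants; (127) at the flat background scales constants by exactly `L^k` -/

include hL in
/-- **`Q_n(1)(const a) = const a`** along the tower — `n` one-step factors, each an exact average at the flat background (§2 at every level,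
the level backgrounds being flat by `UlevOf_one`). [cite: Balaban1985BackgroundPropagators, (3.15) p.393; Balaban1985Averaging, (127) p.37] -/
theorem Qtower_one_const (α : ℕ → ℝ) (hα0 : ∀ n, 0 ≤ α n) (hα1 : ∀ n, α n ≤ 1 / 64) (a : 𝔸) :
    ∀ (n : ℕ) (c : Bond d m),
      Qtower L m hL (UlevOf L m k (fun _ : Bond d (towerP L m k) => (1 : 𝔸ˣ))) α hα1 (perCfg_UlevOf_one_mem_U1 L m k)
        (norm_Wcx_UlevOf_one_sub_one_le L m k α hα0) n (fun _ => a) c = a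
  | 0, _ => rfl
  | n + 1, c => by
    show Qtower L m hL (UlevOf L m k (fun _ : Bond d (towerP L m k) => (1 : 𝔸ˣ))) α hα1 (perCfg_UlevOf_one_mem_U1 L m k)
        (norm_Wcx_UlevOf_one_sub_one_le L m k α hα0) n
        (QtorusLin L (towerP L m n) hL (UlevOf L m k (fun _ : Bond d (towerP L m k) => (1 : 𝔸ˣ)) n) (hα1 n)
          (perCfg_UlevOf_one_mem_U1 L m k n) (norm_Wcx_UlevOf_one_sub_one_le L m k α hα0 n) (fun _ => a)) c = a
    have h1 : QtorusLin L (towerP L m n) hL (UlevOf L m k (fun _ : Bond d (towerP L m k) => (1 : 𝔸ˣ)) n) (hα1 n)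
        (perCfg_UlevOf_one_mem_U1 L m k n) (norm_Wcx_UlevOf_one_sub_one_le L m k α hα0 n) (fun _ => a) = fun _ => a :=
      funext fun b => QtorusLin_const_of_eq_one L hL (towerP L m n) (UlevOf_one L m k n) (hα1 n) _ _ a b
    rw [h1]
    exact Qtower_one_const α hα0 hα1 a n c

include hL in
/-- **THE TOWER NORMALISATION PIN: `Q_k(1)(const a) = const a`** for the composite averaging (3.15) of ONE (flat) background on the finest torus.
[cite: Balaban1985BackgroundPropagators, (3.15) p.393] -/
theorem QkOfU_one_const (α : ℕ → ℝ) (hα0 : ∀ n, 0 ≤ α n) (hα1 : ∀ n, α n ≤ 1 / 64) (a : 𝔸) (c : Bond d m) :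
    QkOfU L m hL k (fun _ : Bond d (towerP L m k) => (1 : 𝔸ˣ)) α hα1 (perCfg_UlevOf_one_mem_U1 L m k)
      (norm_Wcx_UlevOf_one_sub_one_le L m k α hα0) (fun _ => a) c = a :=
  Qtower_one_const L m hL k α hα0 hα1 a k c

include hL in
/-- **The un-normalised composite (127) at the flat background scales `κ`-constants by EXACTLY `L^k`** (read through the identification
`B9Eq315QTower.QkOfU_apply_eq_linCovIter`: the `(L^k)⁻¹` there is what makes `Q_k` an average). [cite: Balaban1985Averaging, (127) p.37; Balaban1985BackgroundPropagators, (3.15) p.393] -/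
theorem linCovIter_one_const (α : ℕ → ℝ) (hα0 : ∀ n, 0 ≤ α n) (hα1 : ∀ n, α n ≤ 1 / 64) (a : 𝔸) (c : Bond d m) :
    linCovIter L (perCfg (towerP L m k) (fun _ : Bond d (towerP L m k) => (1 : 𝔸ˣ)))
        (perCfg (towerP L m k) (fun _ : Bond d (towerP L m k) => a)) k (liftSite c.1) c.2 = ((L : ℂ) ^ k) • a := by
  have h := QkOfU_one_const L m hL k α hα0 hα1 a c
  rw [QkOfU_apply_eq_linCovIter] at h
  have hLk : ((L : ℂ) ^ k) ≠ 0 := pow_ne_zero _ (by exact_mod_cast (NeZero.ne L))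
  calc linCovIter L (perCfg (towerP L m k) (fun _ : Bond d (towerP L m k) => (1 : 𝔸ˣ)))
        (perCfg (towerP L m k) (fun _ : Bond d (towerP L m k) => a)) k (liftSite c.1) c.2
      = ((L : ℂ) ^ k) • (((L : ℂ) ^ k)⁻¹ • linCovIter L (perCfg (towerP L m k) (fun _ : Bond d (towerP L m k) => (1 : 𝔸ˣ)))
          (perCfg (towerP L m k) (fun _ : Bond d (towerP L m k) => a)) k (liftSite c.1) c.2) := by
        rw [smul_smul, mul_inv_cancel₀ hLk, one_smul]
    _ = ((L : ℂ) ^ k) • a := by rw [h]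

/-! ## §4 `Q_k(1)` is onto with no displayed datum -/

include hL in
/-- **`Q_k(1)` IS ONTO with NO displayed datum but `1 ≤ L`**: the flat tower with the profile `α_n := 0` inhabits every hypothesis of
`B9Eq315QTower.QkOfU_surjective` (the regime `50(d+1)·0·L^d ≤ 1/2` trivially). [cite: Balaban1985BackgroundPropagators, (3.15) p.393, (3.126) p.420] -/
theorem QkOfU_one_surjective :
    Function.Surjective (QkOfU L m hL k (fun _ : Bond d (towerP L m k) => (1 : 𝔸ˣ)) (fun _ => 0) (fun _ => by norm_num)
      (perCfg_UlevOf_one_mem_U1 L m k) (norm_Wcx_UlevOf_one_sub_one_le L m k (fun _ => 0) (fun _ => le_rfl))) :=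
  QkOfU_surjective L m hL k _ _ _ _ _ (fun _ => by norm_num)

include hL in
/-- **`Q_{n+1}(1)` on the weighted `L²` spaces of `B9Eq326OperatorTower` IS ONTO with NO displayed datum but `1 ≤ L`** (the same flat tower, read
along the linear chart `φ`). [cite: Balaban1985BackgroundPropagators, (3.15)–(3.16) p.393, (3.126) p.420] -/
theorem QkW_one_surjective (n : ℕ) {W : Type*} [NormedAddCommGroup W] [InnerProductSpace ℂ W] (φ : W ≃ₗ[ℂ] 𝔸) {c₀ c₁ : ℝ} :
    Function.Surjective (QkW L m n φ (fun _ : Bond d (towerP L m (n + 1)) => (1 : 𝔸ˣ)) hL (fun _ => 0) (fun _ => by norm_num)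
      (perCfg_UlevOf_one_mem_U1 L m (n + 1)) (norm_Wcx_UlevOf_one_sub_one_le L m (n + 1) (fun _ => 0) (fun _ => le_rfl))
      (c₀ := c₀) (c₁ := c₁)) :=
  QkW_surjective L m n φ _ hL _ _ _ _ (fun _ => by norm_num)

end Literature.MathematicalPhysics.QuantumFieldTheory.Balaban1983to89.B9Eq315QTowerFlat

end
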